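import Literature.RingTheory.HilbertSamuel.DirectrixGenerizationProof
import Literature.RingTheory.HilbertSamuel.NormalFlatnessCriterion
import Literature.RingTheory.HilbertSamuel.NormalFlatnessLocalization
import Literature.AlgebraicGeometry.CossartJannsenSaito2020.DirectrixGenerizationLocal
import Literature.AlgebraicGeometry.Resolution.RegularLocalRingsQuotient
import Mathlib.RingTheory.KrullDimension.PID
import HarnessLib

/-!
# Cossart–Jannsen–Saito (LNM 2270), Thm. 3.7 PROVED: `e(R_𝔭/J_𝔭) + dim(R/𝔭) ≤ e(R/J)` along a permissible
# `Spec(R/𝔭) ⊂ Spec(R/J)` — discharge of the named fact `CossartJannsenSaito2020_thm_3_7` (F-64)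

Topic: `Literature/AlgebraicGeometry/CossartJannsenSaito2020`. Source: CJS, LNM 2270, Thm. 3.7 (p. 45–46). The book
reduces to `dim(R/𝔭) = 1` by localizing at a prime `R ⊃ 𝔮 ⊃ 𝔭` with `dim R/𝔮 = 1` and induction; here the reduction
is carried out intrinsically on `A = R/J` (as in the tree's Bennett files, `NormalFlatnessCriterion.lean`): for a
prime `𝔭 ⊂ A` with `A/𝔭` regular of dimension `d + 1` and `A` normally flat along `𝔭`, pick `x` with
`x̄ ∈ 𝔪_{A/𝔭} ∖ 𝔪²_{A/𝔭}` and put `𝔮 = 𝔭 + xA`; then `A/𝔮` is regular of dimension `d`, `A` is normally flat along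
`𝔮` (Bennett's numerical criterion both ways: `H^{(0)}[A] = H^{(d+1)}[A_𝔭] ≤ H^{(d)}[A_𝔮] ≤ H^{(0)}[A]`), `A_𝔮` is
normally flat along `𝔭A_𝔮` (localization) with `A_𝔮/𝔭A_𝔮` a discrete valuation ring, so the dimension-one case
(`dirDim_localization_succ_le_dirDim_of_ringKrullDim_eq_one`, file `DirectrixGenerizationProof.lean`) in `A_𝔮` and
the induction hypothesis for `𝔮` give `e(A_𝔭) + d + 1 ≤ e(A_𝔮) + d ≤ e(A)` (`dirDim_localization_add_le_dirDim`).
The printed form (`R` regular local, `J ≤ 𝔭`, `R_𝔭/J_𝔭`) follows since localization commutes with quotients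
(`CossartJannsenSaito2020_thm_3_7_holds`). Cell res-hironaka (HIRONAKA-L librarian seat res-D-lib-1; FACT F-64,
consumers rung L W4.2 (K-ctr)/(c-geo)). AI-written; AI review is weaker than expert review.

## References

* V. Cossart, U. Jannsen, S. Saito, *Desingularization: Invariants and Strategy*, LNM 2270 (2020), Thm. 3.7 (p. 45–46),
  Thm. 3.3, Def. 3.1. [CossartJannsenSaito2020]
* M. Herrmann, S. Ikeda, U. Orbanz, *Equimultiplicity and Blowing up* (1988), Thm. (22.24), Prop. (30.1).
  [HerrmannIkedaOrbanz1988]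
-/

noncomputable section

open IsLocalRing
open Literature.RingTheory.HilbertSamuel Literature.AlgebraicGeometry.Resolution

namespace Literature.AlgebraicGeometry.CossartJannsenSaito2020

universe u

/-- **CJS Thm. 3.7, intrinsic form on `A = R/J`, by induction on `d = dim(A/𝔭)`**: for a noetherian local ring `A`
and a prime `𝔭` with `A/𝔭` regular of dimension `d` along which `A` is normally flat, `e(A_𝔭) + d ≤ e(A)`.
[cite: CossartJannsenSaito2020, Thm. 3.7 (p. 45–46)] -/
theorem dirDim_localization_add_le_dirDim (d : ℕ) :
    ∀ (A : Type u) [CommRing A] [IsLocalRing A] [IsNoetherianRing A] (𝔭 : Ideal A) [𝔭.IsPrime]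
      [IsRegularLocalRing (A ⧸ 𝔭)], 𝔭.IsNormallyFlat → ringKrullDim (A ⧸ 𝔭) = d →
      dirDim (Localization.AtPrime 𝔭) + d ≤ dirDim A := by
  induction d with
  | zero =>
    intro A _ _ _ p _ _ hNF hdim
    have hp := eq_maximalIdeal_of_isRegularLocalRing_quotient_of_ringKrullDim_eq_zero p hdim
    subst hp
    have hle : (maximalIdeal A).primeCompl ≤ IsUnit.submonoid A := fun x hx =>
      (IsLocalRing.notMem_maximalIdeal).mp hx
    haveI : IsNoetherianRing (Localization.AtPrime (maximalIdeal A)) :=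
      IsLocalization.isNoetherianRing (maximalIdeal A).primeCompl _ inferInstance
    have e : A ≃ₐ[A] Localization.AtPrime (maximalIdeal A) :=
      IsLocalization.atUnits A (maximalIdeal A).primeCompl hle
    rw [add_zero, dirDim_eq_of_ringEquiv e.toRingEquiv]
  | succ d ih =>
    intro A _ _ _ p _ _ hNF hdim
    -- an element `x` of `𝔪` whose image in `A/𝔭` lies in `𝔪̄ ∖ 𝔪̄²`
    have hd0 : ringKrullDim (A ⧸ p) ≠ 0 := by
      rw [hdim]; exact_mod_cast Nat.succ_ne_zero d
    obtain ⟨xbar, hxm, hx2⟩ := IsRegularLocalRing.exists_not_mem_sq (R := A ⧸ p) hd0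
    obtain ⟨x, rfl⟩ := Ideal.Quotient.mk_surjective xbar
    obtain ⟨hregq', hdimq'⟩ := IsRegularLocalRing.quotient_span_singleton hxm hx2
    have hxp : x ∉ p := fun h => hx2 (by
      rw [Ideal.Quotient.eq_zero_iff_mem.mpr h]; exact zero_mem _)
    -- `𝔮 = (𝔭, x)`, `A/𝔮 ≅ (A/𝔭)/(x̄)` regular of dimension `d`, prime
    set q : Ideal A := p ⊔ Ideal.span {x} with hq
    have e : (A ⧸ p) ⧸ Ideal.span {Ideal.Quotient.mk p x} ≃+* A ⧸ q := by
      have : Ideal.span {Ideal.Quotient.mk p x} = (Ideal.span {x}).map (Ideal.Quotient.mk p) := by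
        rw [Ideal.map_span, Set.image_singleton]
      exact (Ideal.quotEquivOfEq this).trans (DoubleQuot.quotQuotEquivQuotSup p (Ideal.span {x}))
    haveI := hregq'
    haveI hregq : IsRegularLocalRing (A ⧸ q) := IsRegularLocalRing.of_ringEquiv e
    have hdimq : ringKrullDim (A ⧸ q) = d := by
      rw [← ringKrullDim_eq_of_ringEquiv e]
      obtain ⟨n, hn⟩ := exists_nat_cast_eq_ringKrullDim
        (R := (A ⧸ p) ⧸ Ideal.span {Ideal.Quotient.mk p x})
      rw [hn, hdim] at hdimq'
      rw [hn]
      have : ((n + 1 : ℕ) : WithBot ℕ∞) = ((d + 1 : ℕ) : WithBot ℕ∞) := by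
        push_cast at hdimq' ⊢; exact hdimq'
      have := Nat.cast_injective (R := WithBot ℕ∞) this
      rw [Nat.add_right_cancel this]
    haveI : q.IsPrime := by
      haveI : IsDomain (A ⧸ q) := isDomain_of_isRegularLocalRing _
      exact (Ideal.Quotient.isDomain_iff_prime q).mp inferInstance
    -- (1) Bennett's inequality for `𝔮`: `H^{(d)}[A_𝔮] ≤ H^{(0)}[A]`, and `H^{(0)}[A] = H^{(d+1)}[A_𝔭]` (normal flatness)
    have h1 := hilbertSamuelFun_localization_le_hilbertFun_of_isRegularLocalRing_quotient d q hdimq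
    have hH : hilbertFun A = hilbertSamuelFun (Localization.AtPrime p) (d + 1) :=
      hilbertFun_eq_hilbertSamuelFun_of_isNormallyFlat p (Localization.AtPrime p) hdim hNF
    -- (2) the prime `P = 𝔭A_𝔮` of `A_𝔮`: `𝔪_{A_𝔮} = P + (x)`, `P ≠ 𝔪_{A_𝔮}`
    have hpq : p ≤ q := le_sup_left
    have hdisj : Disjoint (q.primeCompl : Set A) p :=
      Set.disjoint_left.mpr fun a ha hap => ha (hpq hap)
    set Aq := Localization.AtPrime q with hAq
    haveI : IsNoetherianRing Aq := IsLocalization.isNoetherianRing q.primeCompl Aq inferInstance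
    set P : Ideal Aq := p.map (algebraMap A Aq) with hP
    haveI hPprime : P.IsPrime := IsLocalization.isPrime_of_isPrime_disjoint q.primeCompl _ p ‹_› hdisj
    have hPcomap : P.comap (algebraMap A Aq) = p :=
      IsLocalization.under_map_of_isPrime_disjoint q.primeCompl Aq ‹_› hdisj
    have hmax : maximalIdeal Aq = P ⊔ Ideal.span {algebraMap A Aq x} := by
      rw [← IsLocalization.AtPrime.map_eq_maximalIdeal q Aq]
      change Ideal.map (algebraMap A Aq) (p ⊔ Ideal.span {x}) = _
      rw [Ideal.map_sup, Ideal.map_span, Set.image_singleton]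
    have hPne : P ≠ maximalIdeal Aq := by
      intro h
      apply hxp
      rw [← hPcomap, h]
      change x ∈ (maximalIdeal Aq).under A
      rw [IsLocalization.AtPrime.under_maximalIdeal Aq q]
      exact le_sup_right (a := p) (Ideal.mem_span_singleton_self x)
    -- `A_𝔮/P` is a discrete valuation ring: regular of dimension `1`; `A_𝔮` is normally flat along `P`
    haveI : IsPrincipalIdealRing (Aq ⧸ P) := isPrincipalIdealRing_quotient_of_sup_span_eq P hmax
    haveI : Nontrivial (Aq ⧸ P) := Ideal.Quotient.nontrivial_iff.mpr hPprime.ne_top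
    haveI : IsLocalRing (Aq ⧸ P) := IsLocalRing.of_surjective' (Ideal.Quotient.mk P) Ideal.Quotient.mk_surjective
    haveI : IsRegularLocalRing (Aq ⧸ P) := inferInstance
    have hPnf : ¬IsField (Aq ⧸ P) := fun hF =>
      hPne (IsLocalRing.eq_maximalIdeal ((Ideal.Quotient.maximal_ideal_iff_isField_quotient P).mpr hF))
    have hdimP : ringKrullDim (Aq ⧸ P) = 1 := IsPrincipalIdealRing.ringKrullDim_eq_one _ hPnf
    have hPNF : P.IsNormallyFlat := hNF.map_of_isLocalization q.primeCompl Aq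
    -- `T = (A_𝔮)_P` is a localization of `A` at `𝔭`
    haveI hT : IsLocalization.AtPrime (Localization.AtPrime P) p := by
      haveI h := IsLocalization.isLocalization_isLocalization_atPrime_isLocalization q.primeCompl
        (S := Aq) (Localization.AtPrime P) P
      refine IsLocalization.of_le (Ideal.comap (algebraMap A Aq) P).primeCompl
        p.primeCompl (fun r hr => ?_) (fun r hr => ?_)
      · change r ∉ p
        rw [← hPcomap]; exact hr
      · have hr' : r ∈ (Ideal.comap (algebraMap A Aq) P).primeCompl := by
          change r ∉ _
          rw [hPcomap]; exact hr
        exact IsLocalization.map_units (Localization.AtPrime P) (⟨r, hr'⟩ : (Ideal.comap _ P).primeCompl)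
    haveI : IsNoetherianRing (Localization.AtPrime P) :=
      IsLocalization.isNoetherianRing P.primeCompl _ inferInstance
    haveI : IsNoetherianRing (Localization.AtPrime p) :=
      IsLocalization.isNoetherianRing p.primeCompl _ inferInstance
    have eT : Localization.AtPrime P ≃ₐ[A] Localization.AtPrime p :=
      IsLocalization.algEquiv p.primeCompl (Localization.AtPrime P) (Localization.AtPrime p)
    have hdirT : dirDim (Localization.AtPrime p) = dirDim (Localization.AtPrime P) :=
      dirDim_eq_of_ringEquiv eT.toRingEquiv
    -- (3) Bennett in `A_𝔮` for `P` (dimension one): `H^{(1)}[A_𝔭] ≤ H^{(0)}[A_𝔮]`; squeeze ⇒ `𝔮` normally flat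
    have h2 : hilbertSamuelFun (Localization.AtPrime P) 1 ≤ hilbertFun Aq :=
      hilbertSamuelFun_one_le_hilbertFun_of_sup_span_eq P (Localization.AtPrime P) hmax hPne
    have hTRp : hilbertFun (Localization.AtPrime p) = hilbertFun (Localization.AtPrime P) :=
      hilbertFun_eq_of_isLocalization_atPrime p (Localization.AtPrime P)
    have hA : hilbertSamuelFun (Localization.AtPrime p) (d + 1) =
        iterPSum d (hilbertSamuelFun (Localization.AtPrime P) 1) := by
      rw [← iterPSum_hilbertSamuelFun (Localization.AtPrime p) d 1]
      simp only [hilbertSamuelFun, hTRp]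
    have hAB : iterPSum d (hilbertSamuelFun (Localization.AtPrime P) 1) ≤ hilbertSamuelFun Aq d :=
      iterPSum_mono d h2
    have hBeq : hilbertFun A = hilbertSamuelFun Aq d :=
      le_antisymm ((hH.trans hA).le.trans hAB) h1
    have hqNF : q.IsNormallyFlat := isNormallyFlat_of_hilbertFun_eq_hilbertSamuelFun q Aq d hdimq hBeq
    -- (4) induction hypothesis for `𝔮` and the dimension-one case in `A_𝔮`
    have hih : dirDim Aq + d ≤ dirDim A := ih A q hqNF hdimq
    have hone : dirDim (Localization.AtPrime P) + 1 ≤ dirDim Aq :=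
      dirDim_localization_succ_le_dirDim_of_ringKrullDim_eq_one P hPNF hdimP
    rw [hdirT]
    omega

/-- For `J ≤ 𝔭`, the image of `R ∖ 𝔭` in `R ⧸ J` is the complement of `𝔭/J`. [folklore] -/
private theorem algebraMapSubmonoid_primeCompl_eq {R : Type u} [CommRing R] {J 𝔭 : Ideal R} [𝔭.IsPrime]
    (hJ𝔭 : J ≤ 𝔭) [(𝔭.map (Ideal.Quotient.mk J)).IsPrime] :
    Algebra.algebraMapSubmonoid (R ⧸ J) 𝔭.primeCompl = (𝔭.map (Ideal.Quotient.mk J)).primeCompl := by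
  ext x
  obtain ⟨r, rfl⟩ := Ideal.Quotient.mk_surjective x
  simp only [Algebra.algebraMapSubmonoid, Submonoid.mem_map, Ideal.mem_primeCompl_iff,
    Ideal.Quotient.algebraMap_eq, Ideal.mem_quotient_iff_mem_sup, sup_eq_left.mpr hJ𝔭]
  constructor
  · rintro ⟨s, hs, hsr⟩ hr
    rw [Ideal.Quotient.eq] at hsr
    exact hs (by simpa using 𝔭.add_mem (hJ𝔭 hsr) hr)
  · exact fun hr => ⟨r, hr, rfl⟩

/-- **CJS Theorem 3.7 holds** (discharge of the named fact F-64 `CossartJannsenSaito2020_thm_3_7`): for `R` regular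
local, `J ≤ 𝔭` with `Spec(R/𝔭) ⊂ Spec(R/J)` permissible, `e(R_𝔭/J_𝔭) + dim(R/𝔭) ≤ e(R/J)`. Proof: the intrinsic
form `dirDim_localization_add_le_dirDim` on `A = R/J`, `𝔮 = 𝔭/J` (regular quotient and normal flatness from
`Ideal.IsPermissible`), transported along `R_𝔭/J_𝔭 ≅ A_𝔮` (localization commutes with quotients) and
`A/𝔮 ≅ R/𝔭`. [cite: CossartJannsenSaito2020, Thm. 3.7 (p. 45–46)] -/
theorem CossartJannsenSaito2020_thm_3_7_holds : CossartJannsenSaito2020_thm_3_7.{u} := by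
  intro R _ _ J 𝔭 _ _ _ hJ𝔭 hperm
  set 𝔮 : Ideal (R ⧸ J) := 𝔭.map (Ideal.Quotient.mk J) with h𝔮
  haveI h𝔮p : 𝔮.IsPrime :=
    Ideal.map_isPrime_of_surjective Ideal.Quotient.mk_surjective (by rw [Ideal.mk_ker]; exact hJ𝔭)
  haveI : IsRegularLocalRing ((R ⧸ J) ⧸ 𝔮) := hperm.isRegularLocalRing
  obtain ⟨d, hd⟩ := exists_nat_cast_eq_ringKrullDim (R := (R ⧸ J) ⧸ 𝔮)
  have hmain := dirDim_localization_add_le_dirDim d (R ⧸ J) 𝔮 hperm.isNormallyFlat hd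
  -- `S = R_𝔭 / J R_𝔭` is the localization of `R/J` at `𝔮`
  set S := Localization.AtPrime 𝔭 ⧸ J.map (algebraMap R (Localization.AtPrime 𝔭)) with hSdef
  haveI : IsLocalization.AtPrime S 𝔮 := by
    rw [IsLocalization.AtPrime, ← algebraMapSubmonoid_primeCompl_eq hJ𝔭]
    infer_instance
  have e : S ≃ₐ[R ⧸ J] Localization.AtPrime 𝔮 := IsLocalization.algEquiv 𝔮.primeCompl S (Localization.AtPrime 𝔮)
  have hdir : dirDim (Localization.AtPrime 𝔮) = dirDim S := dirDim_eq_of_ringEquiv e.toRingEquiv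
  have eq : ((R ⧸ J) ⧸ 𝔮) ≃+* R ⧸ 𝔭 := DoubleQuot.quotQuotEquivQuotOfLE hJ𝔭
  have hdim : ringKrullDim ((R ⧸ J) ⧸ 𝔮) = ringKrullDim (R ⧸ 𝔭) := ringKrullDim_eq_of_ringEquiv eq
  rw [← hdir, ← hdim, hd]
  exact_mod_cast hmain

/-- **CJS Thm. 3.7, intrinsic and binder-free, for a PERMISSIBLE prime** (`Ideal.IsPermissible`, CJS Def. 3.1 (2)): for a
noetherian local ring `A` and a permissible prime `𝔮 ⊂ A`, `e(A_𝔮) + dim(A/𝔮) ≤ e(A)` in `WithBot ℕ∞` — the shape of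
`dirDim_localization_add_ringKrullDim_le` (`DirectrixGenerizationLocal.lean`) without the embedding `A = R/J` and without
the F-64 hypothesis. [cite: CossartJannsenSaito2020, Thm. 3.7 (p. 45–46)] -/
theorem dirDim_localization_add_ringKrullDim_le_of_isPermissible {A : Type u} [CommRing A] [IsLocalRing A]
    [IsNoetherianRing A] (𝔮 : Ideal A) [𝔮.IsPrime] (h𝔮 : 𝔮.IsPermissible) :
    (dirDim (Localization.AtPrime 𝔮) : WithBot ℕ∞) + ringKrullDim (A ⧸ 𝔮) ≤ (dirDim A : WithBot ℕ∞) := by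
  haveI : IsRegularLocalRing (A ⧸ 𝔮) := h𝔮.isRegularLocalRing
  obtain ⟨d, hd⟩ := exists_nat_cast_eq_ringKrullDim (R := A ⧸ 𝔮)
  rw [hd]
  exact_mod_cast dirDim_localization_add_le_dirDim d A 𝔮 h𝔮.isNormallyFlat hd

end Literature.AlgebraicGeometry.CossartJannsenSaito2020

end
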